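import Summits.RiemannHypothesis.RiemannHypothesis.Theorems.HandoffDodgerFarCost
import Literature.NumberTheory.LFunctions.ZetaArgHSW
import Literature.NumberTheory.LFunctions.SoundZeroWindowSums
import HarnessLib

/-!
# HANDOFF — the FAR ZERO-TAIL of the dodger by STIELTJES integration against `N(t)`: the summation layer (rh-explicit, track «HANDOFF», seat prove-2 gen14, ATTEMPT-24 §1, brick FT)

HONEST FRAMING. Nothing here bears on the truth of RH; this is zero COUNTING. The far-zone cost of the mollified zero-dodger
(`HandoffDodgerCostSum.cost_sum_le`) is a sum over the unkilled zeros `ρ = β + iγ` of the unimodal weight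
`h(γ) = e^{−a/γ²}/γ²` (`a = c/4 ≍ T′³`). The tree's `HandoffDodgerFarCost.far_cost_le` bounds it with the crude unit-window device
(`≈ 220(log √a + 1)/√a`); ATTEMPT-16 Lemma C3 bounds it by partial summation against the zero-counting function `N(t)` with the sharp
density `(1/2π) log(t/2π)` (`≈ (0.0705 log a − 0.10)/√a`, a factor `≈ 10³` smaller). THIS FILE is the summation layer of the sharp form:

* `sum_zerosBetween_le_of_le_count_of_deriv_nonneg` — the NON-DECREASING twin of the tree's Rosser–Schoenfeld partial-summation bound
  (`SchoenfeldBound.sum_zerosBetween_le_of_count_le`): an upper bound from a LOWER count bound `N⁻ ≤ N`;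
* `hasDerivAt_farWeight` and the sign of `h′` on either side of the peak `t = √a`;
* **`far_stieltjes_le`** — for `e ≤ X₁ ≤ X ≤ T₂` (`X = √a`), with `M(t) = (t/2π) log(t/2πe)` and the Hasanalizade–Shen–Wong error
  `s₁(t) = 0.1038 log t + 0.2573 log log t + 9.3675` (tree THEOREM `zetaZeroCount_hasanalizade_shen_wong_holds`):
  `Σ_{X₁ < γ ≤ T₂} m(ρ) h(γ) ≤ 2 s₁(X) h(X) + ∫_{X₁}^{T₂} M′ h + ∫_{X}^{T₂} s₁′ h`
  (partial summation up to the peak with `N ≥ M − s₁`, beyond it with `N ≤ M + s₁`, then integration by parts back onto the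
  explicit majorants; `M′(t) = log(t/2π)/(2π)`, `s₁′(t) = 0.1038/t + 0.2573/(t log t)`).
The explicit evaluation of the two integrals (a fourteen-piece grid) and the resulting cost bound are in the sequel
`HandoffDodgerFarTailBound`. No `sorry`, standard axioms, no definitions.

References: this track (HOME/handoff/prove-2/ATTEMPT-16.md §4 Lemma C3; ATTEMPT-24.md §1). J. B. Rosser, L. Schoenfeld, Math. Comp. 29
(1975), Lemma 7 (partial summation against `N`). E. Hasanalizade, Q. Shen, P.-J. Wong, J. Number Theory 235 (2022), Cor. 1.2 (tree theorem).
-/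

set_option linter.dupNamespace false

noncomputable section

open Real Finset MeasureTheory intervalIntegral Set

namespace Summit.RiemannHypothesis.RiemannHypothesis.Theorems.Handoff

open Literature.NumberTheory.LFunctions Literature.NumberTheory.LFunctions.SchoenfeldBound

/-! ## Partial summation: the non-decreasing twin -/

/-- **Upper bound from `N⁻ ≤ N` for a NON-DECREASING weight**: for `0 ≤ T₁ ≤ T₂`, `f ∈ C¹[T₁,T₂]` with `f′ ≥ 0`, and
`N⁻(t) ≤ N(t)` on `[T₁, T₂]` with `N⁻` continuous,
`Σ_{T₁ < Im ρ ≤ T₂} m(ρ) f(Im ρ) ≤ (N(T₂) − N(T₁)) f(T₂) − ∫_{T₁}^{T₂} (N⁻(t) − N(T₁)) f′(t) dt`.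
[cite: RosserSchoenfeld1975, Lemma 7] -/
theorem sum_zerosBetween_le_of_le_count_of_deriv_nonneg {T₁ T₂ : ℝ} (h0 : 0 ≤ T₁) (h12 : T₁ ≤ T₂)
    {f f' Nlo : ℝ → ℝ} (hf : ∀ t ∈ Icc T₁ T₂, HasDerivAt f (f' t) t) (hf' : ContinuousOn f' (Icc T₁ T₂))
    (hf'0 : ∀ t ∈ Icc T₁ T₂, 0 ≤ f' t)
    (hN : ∀ t ∈ Icc T₁ T₂, Nlo t ≤ (zetaZeroCount t : ℝ)) (hNc : ContinuousOn Nlo (Icc T₁ T₂)) :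
    ∑ ρ ∈ zerosBetween T₁ T₂, (riemannZetaZeroOrder ρ : ℝ) * f ρ.im ≤
      ((zetaZeroCount T₂ : ℝ) - zetaZeroCount T₁) * f T₂ -
        ∫ t in T₁..T₂, (Nlo t - zetaZeroCount T₁) * f' t := by
  rw [sum_zerosBetween_eq h0 h12 hf hf']
  have hIcc : uIcc T₁ T₂ = Icc T₁ T₂ := uIcc_of_le h12
  have h2 : ∫ t in T₁..T₂, (Nlo t - zetaZeroCount T₁) * f' t ≤
      ∫ t in T₁..T₂, ((zetaZeroCount t : ℝ) - zetaZeroCount T₁) * f' t := by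
    refine intervalIntegral.integral_mono_on h12 ?_ ?_ fun t ht ↦ ?_
    · exact ((hNc.sub continuousOn_const).mul hf').intervalIntegrable_of_Icc h12
    · exact intervalIntegrable_count_sub_mul (by rw [hIcc]; exact hf')
    · exact mul_le_mul_of_nonneg_right (by linarith [hN t ht]) (hf'0 t ht)
  linarith

/-! ## The weight `h(t) = e^{−a/t²}/t²` and its derivative -/

/-- `h′(t) = 2e^{−a/t²}(a − t²)/t⁵` for `t ≠ 0`. [folklore] -/
theorem hasDerivAt_farWeight (a : ℝ) {t : ℝ} (ht : t ≠ 0) :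
    HasDerivAt (fun s : ℝ => Real.exp (-a / s ^ 2) / s ^ 2) (2 * Real.exp (-a / t ^ 2) * (a - t ^ 2) / t ^ 5) t := by
  have hp : HasDerivAt (fun s : ℝ => s ^ 2) (2 * t) t := by
    simpa using hasDerivAt_pow 2 t
  have hI : HasDerivAt (fun s : ℝ => (s ^ 2)⁻¹) (-(2 * t) / (t ^ 2) ^ 2) t := hp.inv (pow_ne_zero 2 ht)
  have h1 : HasDerivAt (fun s : ℝ => -a / s ^ 2) (-a * (-(2 * t) / (t ^ 2) ^ 2)) t := by
    have := hI.const_mul (-a)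
    simpa [div_eq_mul_inv] using this
  have hE : HasDerivAt (fun s : ℝ => Real.exp (-a / s ^ 2)) (Real.exp (-a / t ^ 2) * (-a * (-(2 * t) / (t ^ 2) ^ 2))) t :=
    h1.exp
  have hM := hE.mul hI
  have e1 : (fun s : ℝ => Real.exp (-a / s ^ 2) / s ^ 2) = fun s => Real.exp (-a / s ^ 2) * (s ^ 2)⁻¹ := by
    ext s; rw [div_eq_mul_inv]
  rw [e1]
  refine hM.congr_deriv ?_
  have ht2 : t ^ 2 ≠ 0 := pow_ne_zero 2 ht
  field_simp
  ring

/-- `h′ ≥ 0` below the peak: `0 < t`, `t² ≤ a`. [folklore] -/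
theorem farWeight_deriv_nonneg {a t : ℝ} (ht : 0 < t) (hta : t ^ 2 ≤ a) :
    0 ≤ 2 * Real.exp (-a / t ^ 2) * (a - t ^ 2) / t ^ 5 := by
  have : 0 ≤ a - t ^ 2 := by linarith
  positivity

/-- `h′ ≤ 0` beyond the peak: `0 < t`, `a ≤ t²`. [folklore] -/
theorem farWeight_deriv_nonpos {a t : ℝ} (ht : 0 < t) (hta : a ≤ t ^ 2) :
    2 * Real.exp (-a / t ^ 2) * (a - t ^ 2) / t ^ 5 ≤ 0 := by
  have h1 : a - t ^ 2 ≤ 0 := by linarith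
  have h2 : 0 ≤ 2 * Real.exp (-a / t ^ 2) := by positivity
  exact div_nonpos_of_nonpos_of_nonneg (mul_nonpos_of_nonneg_of_nonpos h2 h1) (by positivity)

/-- The weight is non-decreasing below the peak: `0 < t ≤ u`, `u² ≤ a` ⟹ `h(t) ≤ h(u)`
(`h = (x e^{−x})/a` with `x = a/t² ≥ a/u² ≥ 1`, and `x e^{−x}` is non-increasing on `[1, ∞)`). [folklore] -/
theorem farWeight_mono_below {a t u : ℝ} (ht : 0 < t) (htu : t ≤ u) (hua : u ^ 2 ≤ a) :
    Real.exp (-a / t ^ 2) / t ^ 2 ≤ Real.exp (-a / u ^ 2) / u ^ 2 := by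
  have hu : 0 < u := lt_of_lt_of_le ht htu
  have ha : 0 < a := lt_of_lt_of_le (by positivity) hua
  -- `x = a/t²`, `y = a/u²`, `1 ≤ y ≤ x`; claim `x e^{-x} ≤ y e^{-y}`, i.e. `x/y ≤ e^{x-y}` ⟸ `1 + (x−y) ≥ x/y` ⟸ `(y−1)(x−y) ≥ 0`.
  set x : ℝ := a / t ^ 2 with hx
  set y : ℝ := a / u ^ 2 with hy
  have hy1 : 1 ≤ y := by rw [hy, le_div_iff₀ (by positivity)]; linarith
  have hyx : y ≤ x := by
    rw [hx, hy]; exact div_le_div_of_nonneg_left ha.le (by positivity) (pow_le_pow_left₀ ht.le htu 2)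
  have hy0 : 0 < y := by linarith
  have key : x * Real.exp (-x) ≤ y * Real.exp (-y) := by
    have h1 : x ≤ y * (1 + (x - y)) := by nlinarith
    have h2 : 1 + (x - y) ≤ Real.exp (x - y) := by linarith [Real.add_one_le_exp (x - y)]
    have h3 : x ≤ y * Real.exp (x - y) := h1.trans (mul_le_mul_of_nonneg_left h2 hy0.le)
    have h4 : Real.exp (x - y) * Real.exp (-x) = Real.exp (-y) := by rw [← Real.exp_add]; ring_nf
    calc x * Real.exp (-x) ≤ y * Real.exp (x - y) * Real.exp (-x) :=
          mul_le_mul_of_nonneg_right h3 (Real.exp_pos _).le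
      _ = y * Real.exp (-y) := by rw [mul_assoc, h4]
  have e1 : Real.exp (-a / t ^ 2) / t ^ 2 = x * Real.exp (-x) / a := by
    rw [hx]; field_simp
  have e2 : Real.exp (-a / u ^ 2) / u ^ 2 = y * Real.exp (-y) / a := by
    rw [hy]; field_simp
  rw [e1, e2]
  exact div_le_div_of_nonneg_right key ha.le

/-! ## Calculus of the majorants `M ± s₁` -/

/-- `M(t) = (t/2π) log(t/2πe)` has derivative `log(t/2π)/(2π)` at `t > 0`. [folklore] -/
theorem hasDerivAt_countMainHSW {t : ℝ} (ht : 0 < t) :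
    HasDerivAt (fun s : ℝ => s / (2 * π) * Real.log (s / (2 * π * Real.exp 1))) (Real.log (t / (2 * π)) / (2 * π)) t := by
  have hπ := Real.pi_pos
  have hc : (0 : ℝ) < 2 * π * Real.exp 1 := by positivity
  have h1 : HasDerivAt (fun s : ℝ => s / (2 * π)) (1 / (2 * π)) t := by
    simpa using (hasDerivAt_id t).div_const (2 * π)
  have h2 : HasDerivAt (fun s : ℝ => s / (2 * π * Real.exp 1)) (1 / (2 * π * Real.exp 1)) t := by
    simpa using (hasDerivAt_id t).div_const (2 * π * Real.exp 1)
  have h3 : HasDerivAt (fun s : ℝ => Real.log (s / (2 * π * Real.exp 1)))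
      ((1 / (2 * π * Real.exp 1)) / (t / (2 * π * Real.exp 1))) t := h2.log (by positivity)
  have h4 := h1.mul h3
  refine h4.congr_deriv ?_
  have hlog : Real.log (t / (2 * π * Real.exp 1)) = Real.log (t / (2 * π)) - 1 := by
    rw [Real.log_div ht.ne' hc.ne', Real.log_div ht.ne' (by positivity), Real.log_mul (by positivity) (Real.exp_pos 1).ne',
      Real.log_exp]
    ring
  rw [hlog]
  field_simp
  ring

/-- `s₁(t) = 0.1038 log t + 0.2573 log log t + 9.3675` has derivative `0.1038/t + 0.2573/(t log t)` at `t > 1`. [folklore] -/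
theorem hasDerivAt_hswErr {t : ℝ} (ht : 1 < t) :
    HasDerivAt (fun s : ℝ => 0.1038 * Real.log s + 0.2573 * Real.log (Real.log s) + 9.3675)
      (0.1038 / t + 0.2573 / (t * Real.log t)) t := by
  have ht0 : t ≠ 0 := by positivity
  have hlog : Real.log t ≠ 0 := (Real.log_pos ht).ne'
  have h1 : HasDerivAt (fun s : ℝ => Real.log s) (t⁻¹) t := Real.hasDerivAt_log ht0
  have h2 : HasDerivAt (fun s : ℝ => Real.log (Real.log s)) (t⁻¹ / Real.log t) t := h1.log hlog
  have h3 := ((h1.const_mul 0.1038).add (h2.const_mul 0.2573)).add_const 9.3675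
  refine h3.congr_deriv ?_
  field_simp

/-! ## The Stieltjes bound -/

/-- **The far zero-tail by Stieltjes integration (summation layer).** For `e ≤ X₁ ≤ X ≤ T₂` and the weight
`h(t) = e^{−X²/t²}/t²` (peak at `t = X`, `h(X) = e^{−1}/X²`):
`Σ_{X₁ < Im ρ ≤ T₂} m(ρ) h(Im ρ) ≤ 2 s₁(X) e^{−1}/X² + ∫_{X₁}^{T₂} (log(t/2π)/(2π)) h(t) dt + ∫_X^{T₂} (0.1038/t + 0.2573/(t log t)) h(t) dt`,
where `s₁(t) = 0.1038 log t + 0.2573 log log t + 9.3675` is the Hasanalizade–Shen–Wong error of `N(t)` (tree theorem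
`zetaZeroCount_hasanalizade_shen_wong_holds`). Proof: partial summation on `(X₁, X]` with the lower count bound `N ≥ M − s₁`
(`h` non-decreasing there) and on `(X, T₂]` with the upper bound `N ≤ M + s₁` (`h` non-increasing), then integration by parts
back onto the explicit majorants. RH-free zero counting. [this track, ATTEMPT-16 Lemma C3; ATTEMPT-24 §1] -/
theorem far_stieltjes_le {X₁ X T₂ : ℝ} (hX₁ : Real.exp 1 ≤ X₁) (h1X : X₁ ≤ X) (hXT : X ≤ T₂) :
    ∑ ρ ∈ zerosBetween X₁ T₂, (riemannZetaZeroOrder ρ : ℝ) * (Real.exp (-X ^ 2 / ρ.im ^ 2) / ρ.im ^ 2) ≤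
      2 * (0.1038 * Real.log X + 0.2573 * Real.log (Real.log X) + 9.3675) * (Real.exp (-1) / X ^ 2) +
      (∫ t in X₁..T₂, Real.log (t / (2 * π)) / (2 * π) * (Real.exp (-X ^ 2 / t ^ 2) / t ^ 2)) +
      ∫ t in X..T₂, (0.1038 / t + 0.2573 / (t * Real.log t)) * (Real.exp (-X ^ 2 / t ^ 2) / t ^ 2) := by
  have hπ := Real.pi_pos
  have he1 : (1 : ℝ) < Real.exp 1 := by have := Real.exp_one_gt_d9; linarith
  have hX₁1 : 1 < X₁ := lt_of_lt_of_le he1 hX₁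
  have hX₁0 : 0 < X₁ := by linarith
  have hX0 : 0 < X := by linarith
  have hX1 : 1 < X := by linarith
  have h1T : X₁ ≤ T₂ := h1X.trans hXT
  -- the players
  set N : ℝ → ℝ := fun t => (zetaZeroCount t : ℝ) with hN
  set w : ℝ → ℝ := fun t => Real.exp (-X ^ 2 / t ^ 2) / t ^ 2 with hw
  set w' : ℝ → ℝ := fun t => 2 * Real.exp (-X ^ 2 / t ^ 2) * (X ^ 2 - t ^ 2) / t ^ 5 with hw'
  set M : ℝ → ℝ := fun t => t / (2 * π) * Real.log (t / (2 * π * Real.exp 1)) with hM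
  set M' : ℝ → ℝ := fun t => Real.log (t / (2 * π)) / (2 * π) with hM'
  set S : ℝ → ℝ := fun t => 0.1038 * Real.log t + 0.2573 * Real.log (Real.log t) + 9.3675 with hS
  set S' : ℝ → ℝ := fun t => 0.1038 / t + 0.2573 / (t * Real.log t) with hS'
  show ∑ ρ ∈ zerosBetween X₁ T₂, (riemannZetaZeroOrder ρ : ℝ) * w ρ.im ≤
      2 * S X * (Real.exp (-1) / X ^ 2) + (∫ t in X₁..T₂, M' t * w t) + ∫ t in X..T₂, S' t * w t
  -- pointwise calculus facts on `[X₁, ∞)`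
  have hwd : ∀ t : ℝ, 0 < t → HasDerivAt w (w' t) t := fun t ht => hasDerivAt_farWeight (X ^ 2) ht.ne'
  have hMd : ∀ t : ℝ, 0 < t → HasDerivAt M (M' t) t := fun t ht => hasDerivAt_countMainHSW ht
  have hSd : ∀ t : ℝ, 1 < t → HasDerivAt S (S' t) t := fun t ht => hasDerivAt_hswErr ht
  have hw'c : ∀ t : ℝ, t ≠ 0 → ContinuousAt w' t := fun t ht => by
    simp only [hw']
    fun_prop (disch := positivity)
  have hwc : ∀ t : ℝ, t ≠ 0 → ContinuousAt w t := fun t ht => by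
    simp only [hw]
    fun_prop (disch := positivity)
  have hM'c : ∀ t : ℝ, 0 < t → ContinuousAt M' t := fun t ht => by
    simp only [hM']
    fun_prop (disch := positivity)
  have hS'c : ∀ t : ℝ, 1 < t → ContinuousAt S' t := fun t ht => by
    have h0 : t ≠ 0 := by positivity
    have hl : Real.log t ≠ 0 := (Real.log_pos ht).ne'
    have htl : t * Real.log t ≠ 0 := mul_ne_zero h0 hl
    simp only [hS']
    fun_prop (disch := assumption)
  have hMc : ∀ t : ℝ, 0 < t → ContinuousAt M t := fun t ht => (hMd t ht).continuousAt
  have hSc : ∀ t : ℝ, 1 < t → ContinuousAt S t := fun t ht => (hSd t ht).continuousAt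
  -- continuity on the intervals
  have cw' : ∀ a b : ℝ, X₁ ≤ a → ContinuousOn w' (Icc a b) := fun a b ha =>
    continuousOn_of_forall_continuousAt fun t ht => hw'c t (by linarith [ht.1])
  have cw : ∀ a b : ℝ, X₁ ≤ a → ContinuousOn w (Icc a b) := fun a b ha =>
    continuousOn_of_forall_continuousAt fun t ht => hwc t (by linarith [ht.1])
  have cM' : ∀ a b : ℝ, X₁ ≤ a → ContinuousOn M' (Icc a b) := fun a b ha =>
    continuousOn_of_forall_continuousAt fun t ht => hM'c t (by linarith [ht.1])
  have cS' : ∀ a b : ℝ, X₁ ≤ a → ContinuousOn S' (Icc a b) := fun a b ha =>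
    continuousOn_of_forall_continuousAt fun t ht => hS'c t (by linarith [ht.1])
  have cM : ∀ a b : ℝ, X₁ ≤ a → ContinuousOn M (Icc a b) := fun a b ha =>
    continuousOn_of_forall_continuousAt fun t ht => hMc t (by linarith [ht.1])
  have cS : ∀ a b : ℝ, X₁ ≤ a → ContinuousOn S (Icc a b) := fun a b ha =>
    continuousOn_of_forall_continuousAt fun t ht => hSc t (by linarith [ht.1])
  -- interval integrability of the products we meet
  have iI : ∀ {f : ℝ → ℝ} {a b : ℝ}, a ≤ b → ContinuousOn f (Icc a b) → IntervalIntegrable f volume a b :=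
    fun hab hf => hf.intervalIntegrable_of_Icc hab
  -- HSW: `M − S ≤ N ≤ M + S` on `[X₁, ∞)`
  have hHSW : ∀ t : ℝ, X₁ ≤ t → M t - S t ≤ N t ∧ N t ≤ M t + S t := fun t ht => by
    have h := abs_le.1 (zetaZeroCount_hasanalizade_shen_wong_holds t (hX₁.trans ht))
    simp only [hM, hS, hN]
    constructor <;> linarith [h.1, h.2]
  -- nonnegativity of the weight and of `S'`
  have hw0 : ∀ t : ℝ, 0 ≤ w t := fun t => by simp only [hw]; positivity
  have hS'0 : ∀ t : ℝ, 1 < t → 0 ≤ S' t := fun t ht => by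
    have := Real.log_pos ht
    simp only [hS']; positivity
  ----------------------------------------------------------------
  -- STEP 1: split at the peak `X`
  rw [SoundTest.sum_zerosBetween_split hX₁0.le h1X hXT]
  ----------------------------------------------------------------
  -- STEP 2: below the peak, partial summation with the LOWER count bound
  have hlo : ∑ ρ ∈ zerosBetween X₁ X, (riemannZetaZeroOrder ρ : ℝ) * w ρ.im ≤
      (N X - N X₁) * w X - ∫ t in X₁..X, (M t - S t - N X₁) * w' t := by
    have h := sum_zerosBetween_le_of_le_count_of_deriv_nonneg hX₁0.le h1X (f := w) (f' := w')
      (Nlo := fun t => M t - S t) (fun t ht => hwd t (by linarith [ht.1])) (cw' X₁ X le_rfl)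
      (fun t ht => farWeight_deriv_nonneg (by linarith [ht.1]) (pow_le_pow_left₀ (by linarith [ht.1]) ht.2 2))
      (fun t ht => (hHSW t ht.1).1) ((cM X₁ X le_rfl).sub (cS X₁ X le_rfl))
    simpa only [hN] using h
  -- by parts below the peak
  have hbp1 : ∫ t in X₁..X, (M t - S t - N X₁) * w' t =
      (M X - S X - N X₁) * w X - (M X₁ - S X₁ - N X₁) * w X₁ - ∫ t in X₁..X, (M' t - S' t) * w t := by
    have hu : ∀ t ∈ uIcc X₁ X, HasDerivAt (fun s => M s - S s - N X₁) (M' t - S' t) t := by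
      intro t ht
      rw [uIcc_of_le h1X] at ht
      have ht0 : 0 < t := by linarith [ht.1]
      have ht1 : 1 < t := by linarith [ht.1]
      exact ((hMd t ht0).sub (hSd t ht1)).sub_const _
    have hv : ∀ t ∈ uIcc X₁ X, HasDerivAt w (w' t) t := by
      intro t ht
      rw [uIcc_of_le h1X] at ht
      exact hwd t (by linarith [ht.1])
    exact intervalIntegral.integral_mul_deriv_eq_deriv_mul hu hv
      (iI h1X ((cM' X₁ X le_rfl).sub (cS' X₁ X le_rfl))) (iI h1X (cw' X₁ X le_rfl))
  ----------------------------------------------------------------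
  -- STEP 3: beyond the peak, partial summation with the UPPER count bound (tree lemma)
  have hhi : ∑ ρ ∈ zerosBetween X T₂, (riemannZetaZeroOrder ρ : ℝ) * w ρ.im ≤
      (M T₂ + S T₂ - N X) * w T₂ + ∫ t in X..T₂, (M t + S t - N X) * (-w' t) := by
    have h := sum_zerosBetween_le_of_count_le hX0.le hXT (f := w) (f' := w') (Nup := fun t => M t + S t)
      (fun t ht => hwd t (by linarith [ht.1])) (cw' X T₂ h1X)
      (fun t ht => farWeight_deriv_nonpos (by linarith [ht.1]) (pow_le_pow_left₀ hX0.le ht.1 2))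
      (hw0 T₂) (fun t ht => (hHSW t (h1X.trans ht.1)).2) ((cM X T₂ h1X).add (cS X T₂ h1X))
    simpa only [hN] using h
  -- by parts beyond the peak
  have hbp2 : ∫ t in X..T₂, (M t + S t - N X) * w' t =
      (M T₂ + S T₂ - N X) * w T₂ - (M X + S X - N X) * w X - ∫ t in X..T₂, (M' t + S' t) * w t := by
    have hu : ∀ t ∈ uIcc X T₂, HasDerivAt (fun s => M s + S s - N X) (M' t + S' t) t := by
      intro t ht
      rw [uIcc_of_le hXT] at ht
      have ht0 : 0 < t := by linarith [ht.1]
      have ht1 : 1 < t := by linarith [ht.1]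
      exact ((hMd t ht0).add (hSd t ht1)).sub_const _
    have hv : ∀ t ∈ uIcc X T₂, HasDerivAt w (w' t) t := by
      intro t ht
      rw [uIcc_of_le hXT] at ht
      exact hwd t (by linarith [ht.1])
    exact intervalIntegral.integral_mul_deriv_eq_deriv_mul hu hv
      (iI hXT ((cM' X T₂ h1X).add (cS' X T₂ h1X))) (iI hXT (cw' X T₂ h1X))
  have hneg : ∫ t in X..T₂, (M t + S t - N X) * (-w' t) = -∫ t in X..T₂, (M t + S t - N X) * w' t := by
    rw [← intervalIntegral.integral_neg]
    refine intervalIntegral.integral_congr fun t _ => ?_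
    ring
  ----------------------------------------------------------------
  -- STEP 4: the explicit integrals
  have iM'w1 : IntervalIntegrable (fun t => M' t * w t) volume X₁ X := iI h1X ((cM' X₁ X le_rfl).mul (cw X₁ X le_rfl))
  have iM'w2 : IntervalIntegrable (fun t => M' t * w t) volume X T₂ := iI hXT ((cM' X T₂ h1X).mul (cw X T₂ h1X))
  have iS'w1 : IntervalIntegrable (fun t => S' t * w t) volume X₁ X := iI h1X ((cS' X₁ X le_rfl).mul (cw X₁ X le_rfl))
  have iS'w2 : IntervalIntegrable (fun t => S' t * w t) volume X T₂ := iI hXT ((cS' X T₂ h1X).mul (cw X T₂ h1X))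
  have hsplit1 : ∫ t in X₁..X, (M' t - S' t) * w t = (∫ t in X₁..X, M' t * w t) - ∫ t in X₁..X, S' t * w t := by
    rw [← intervalIntegral.integral_sub iM'w1 iS'w1]
    refine intervalIntegral.integral_congr fun t _ => ?_
    ring
  have hsplit2 : ∫ t in X..T₂, (M' t + S' t) * w t = (∫ t in X..T₂, M' t * w t) + ∫ t in X..T₂, S' t * w t := by
    rw [← intervalIntegral.integral_add iM'w2 iS'w2]
    refine intervalIntegral.integral_congr fun t _ => ?_
    ring
  have hadj : (∫ t in X₁..X, M' t * w t) + ∫ t in X..T₂, M' t * w t = ∫ t in X₁..T₂, M' t * w t :=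
    intervalIntegral.integral_add_adjacent_intervals iM'w1 iM'w2
  have hS'pos : 0 ≤ ∫ t in X₁..X, S' t * w t :=
    intervalIntegral.integral_nonneg h1X fun t ht => mul_nonneg (hS'0 t (by linarith [ht.1])) (hw0 t)
  -- the boundary terms
  have hbdry : (M X₁ - S X₁ - N X₁) * w X₁ ≤ 0 :=
    mul_nonpos_of_nonpos_of_nonneg (by linarith [(hHSW X₁ le_rfl).1]) (hw0 X₁)
  have hwX : w X = Real.exp (-1) / X ^ 2 := by
    simp only [hw]
    rw [neg_div, div_self (pow_ne_zero 2 hX0.ne')]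
  ----------------------------------------------------------------
  -- STEP 5: assemble
  rw [← hwX]
  have hsum := add_le_add hlo hhi
  rw [hbp1, hneg, hbp2, hsplit1, hsplit2] at hsum
  nlinarith [hsum, hadj, hS'pos, hbdry, hw0 X]

end Summit.RiemannHypothesis.RiemannHypothesis.Theorems.Handoff

end
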